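import Mathlib
import Summits.Ventures.HodgeRepro.Tier4.Line4.ConvProduct
import Summits.Ventures.HodgeRepro.Tier4.Line4.ProductWitness
import Summits.Ventures.HodgeRepro.Tier4.Line4.LevelVolume

/-!
# Tier4/Line4/ConvLevelWitness — the finite convolution of the natural witness with the level indicator is a scalar
multiple of the witness: `ffinLevel N ⋆ 1_{K(N)} = μ_f(K(N)) · ffinLevel N`

Blind re-derivation cell `pub-hodge-repro`, Tier 4 «prove the step» (README §9–§10), seat t4-L2-p1 (gen 3; the
convolution-family `hmain` question S15293, crit-1 Entry 152 S15296).  Tree path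
`lean/Summits/Ventures/HodgeRepro/Tier4/Line4/ConvLevelWitness.lean`.  Imports `Line4/ConvProduct` (p697081: `convFin`),
`Line4/ProductWitness` (p704125: `levelInd`), `Line4/LevelVolume` (p702383: `ffinLevel`).  Mathlib-level.

THE IDENTITY.  `convFin μ_f (ffinLevel N) (levelInd N) x = ∫_{y ∈ G(𝔸_f)} ffinLevel N (y) · 1[y⁻¹ x_f ∈ K(N)] dμ_f(y)`; on
`y ∈ x_f K(N)` the witness is constant (`ffinLevel` is right-`K(N)`-invariant: `K γ₀ K · K = K γ₀ K`), so the integral is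
`ffinLevel N (x) · μ_f(x_f K(N)) = μ_f(K(N)) · ffinLevel N (x)` (left invariance of the Haar measure on `G(𝔸_f)`).  Hence the
finite factor of the convolution family `(finf ⊗ ffinLevel N) ⋆ (e ⊗ 1_{K(N)})` is `μ_f(K(N)) · ffinLevel N`, and its main
term is the product family's (HorbLevel / SuppMeasure) times `μ_f(K(N))` — the factor crit-1 Entry 152 records.

Nothing here says anything about the status of the Hodge conjecture for CM abelian varieties, which is NOT proved
(HC_CM is NOT proved by anyone in this repository).
-/

set_option autoImplicit false
noncomputable section
namespace Summit.Ventures.HodgeRepro.Tier4.Line4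
open Summit.Ventures.HodgeRepro.Tier4 Summit.Ventures.HodgeRepro.Tier4.Common
  Summit.Ventures.HodgeRepro.Tier4.Line1 MeasureTheory
open scoped Topology Pointwise NNReal ENNReal

section RightInv
variable {k : Type} [Field k] [NumberField k] (W : PlaneData k) [MeasurableSpace (GA W)]
  (νf : Measure (torusFin W)) (νf' : Measure (torusFin' W)) (γ₀ : GA W) (N : ℕ)

omit [MeasurableSpace (GA W)] in
/-- The level double coset is right-`K(N)`-stable. -/
theorem levelDoubleCoset_mul_mem {g κ : GA W} (hg : g ∈ levelDoubleCoset W N (GA.ofFinPart W γ₀))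
    (hκ : κ ∈ levelK W N) : g * κ ∈ levelDoubleCoset W N (GA.ofFinPart W γ₀) := by
  obtain ⟨a, ha, c, hc, rfl⟩ := exists_eq_mul_of_mem_mul_singleton_mul W _ _ _ hg
  rw [mul_assoc]
  exact Set.mul_mem_mul (Set.mul_mem_mul ha (Set.mem_singleton _)) (mul_mem hc hκ)

/-- **`ffinLevel` is right-`K(N)`-invariant** on `G(𝔸_f)`: `ffinLevel N (g κ) = ffinLevel N g` for `κ ∈ K(N)`. -/
theorem ffinLevel_mul_of_mem {g κ : GA W} (hg : g ∈ finitePart W) (hκ : κ ∈ levelK W N) :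
    ffinLevel W νf νf' γ₀ N (g * κ) = ffinLevel W νf νf' γ₀ N g := by
  have hgκ : g * κ ∈ finitePart W := (finitePart W).mul_mem hg (levelK_le_finitePart W N hκ)
  unfold ffinLevel
  rw [ofFinPart_eq_self_of_mem_finitePart W hg, ofFinPart_eq_self_of_mem_finitePart W hgκ]
  by_cases h : g ∈ levelDoubleCoset W N (GA.ofFinPart W γ₀)
  · rw [Set.indicator_of_mem h, Set.indicator_of_mem (levelDoubleCoset_mul_mem W γ₀ N h hκ)]
  · have h' : g * κ ∉ levelDoubleCoset W N (GA.ofFinPart W γ₀) := by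
      intro h'
      have := levelDoubleCoset_mul_mem W γ₀ N h' (inv_mem hκ)
      rw [mul_inv_cancel_right] at this
      exact h this
    rw [Set.indicator_of_notMem h, Set.indicator_of_notMem h']

end RightInv

section Conv
variable {k : Type} [Field k] [NumberField k] (W : PlaneData k) [MeasurableSpace (GA W)] [BorelSpace (GA W)]
  (νf : Measure (torusFin W)) (νf' : Measure (torusFin' W)) (γ₀ : GA W) (N : ℕ)

/-- **The finite convolution of the natural witness with the level indicator**: for a Haar measure `μ_f` on `G(𝔸_f)`,
`convFin μ_f (ffinLevel N) (levelInd N) x = μ_f(K(N)) · ffinLevel N x` (`N ≠ 0`). -/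
theorem convFin_ffinLevel_levelInd (μfin : Measure (finitePart W)) [μfin.IsHaarMeasure] (hN : N ≠ 0) (x : GA W) :
    convFin W μfin (ffinLevel W νf νf' γ₀ N) (levelInd W N) x =
      (μfin {y : finitePart W | (y : GA W) ∈ levelK W N}).toReal * ffinLevel W νf νf' γ₀ N x := by
  haveI : T2Space (GA W) := t2Space_GA W
  haveI : BorelSpace (finitePart W) := Subtype.borelSpace _
  set xf : finitePart W := ⟨GA.ofFinPart W x, ofFinPart_mem_finitePart W x⟩ with hxf
  -- the level set in `G(𝔸_f)` and its translate
  set K' : Set (finitePart W) := {y | (y : GA W) ∈ levelK W N} with hK'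
  have hK'm : MeasurableSet K' :=
    ((isCompact_levelK W hN).isClosed.preimage continuous_subtype_val).measurableSet
  set S : Set (finitePart W) := (fun y : finitePart W => xf⁻¹ * y) ⁻¹' K' with hS
  have hSm : MeasurableSet S := hK'm.preimage (measurable_const_mul xf⁻¹)
  -- the integrand is `ffinLevel N x · 1_S`
  have hint : ∀ y : finitePart W, ffinLevel W νf νf' γ₀ N (y : GA W) * levelInd W N ((y : GA W)⁻¹ * GA.ofFinPart W x) =
      S.indicator (fun _ => ffinLevel W νf νf' γ₀ N x) y := by
    intro y
    have hyx : GA.ofFinPart W ((y : GA W)⁻¹ * GA.ofFinPart W x) = (y : GA W)⁻¹ * GA.ofFinPart W x :=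
      ofFinPart_eq_self_of_mem_finitePart W ((finitePart W).mul_mem ((finitePart W).inv_mem y.2)
        (ofFinPart_mem_finitePart W x))
    have hmemS : y ∈ S ↔ (y : GA W)⁻¹ * GA.ofFinPart W x ∈ levelK W N := by
      show ((xf⁻¹ * y : finitePart W) : GA W) ∈ levelK W N ↔ _
      rw [Subgroup.coe_mul, Subgroup.coe_inv]
      constructor
      · intro h
        have := inv_mem h
        rwa [mul_inv_rev, inv_inv] at this
      · intro h
        have := inv_mem h
        rwa [mul_inv_rev, inv_inv] at this
    by_cases hy : y ∈ S
    · have h1 : levelInd W N ((y : GA W)⁻¹ * GA.ofFinPart W x) = 1 :=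
        levelInd_eq_one_of_mem W (by rw [hyx]; exact hmemS.1 hy)
      rw [Set.indicator_of_mem hy, h1, mul_one]
      -- `x_f = y · (y⁻¹ x_f)` with `y⁻¹ x_f ∈ K(N)`: right invariance
      have hx : GA.ofFinPart W x = (y : GA W) * ((y : GA W)⁻¹ * GA.ofFinPart W x) := by group
      rw [← ffinLevel_ofFinPart W νf νf' γ₀ N x, hx, ffinLevel_mul_of_mem W νf νf' γ₀ N y.2 (hmemS.1 hy)]
    · have h0 : levelInd W N ((y : GA W)⁻¹ * GA.ofFinPart W x) = 0 :=
        levelInd_eq_zero_of_notMem W (by rw [hyx]; exact fun h => hy (hmemS.2 h))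
      rw [Set.indicator_of_notMem hy, h0, mul_zero]
  unfold convFin
  simp_rw [hint]
  rw [integral_indicator hSm, setIntegral_const, Complex.real_smul, measureReal_def, hS,
    measure_preimage_mul μfin xf⁻¹ K']

end Conv

end Summit.Ventures.HodgeRepro.Tier4.Line4

end
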